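import Mathlib
import Literature.NumberTheory.LFunctions.Zhang2022.TypedSection13
import HarnessLib

/-!
# Zhang (2022) §13, kernel-checked EDGES between the typed displays of p. 74

Topic `Literature/NumberTheory/LFunctions/Zhang2022` (Landau–Siegel audit tree; verdict-neutral).
Y. Zhang, *Discrete mean estimates and the Landau–Siegel zero*, arXiv:2211.02515v1 (2022)
[Zhang2022LandauSiegel], §13 pp. 74–75 — an unrefereed manuscript under adjudication. This file
asserts NO claim of the manuscript: it proves IMPLICATIONS between the typed displays of
`TypedSection13` (namespace `…Zhang2022.Typed.Section13`) and the banked skeleton nodes, i.e. it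
kernel-checks the manuscript's inferences (13.1)⇒(13.1′), u001+u002⇒(13.2), (13.1)+(13.2)+u003⇒(13.3) in the author's order (the leaf steps u001/u002/u003 themselves are other seats' discharges; the conjugation / critical-line helpers below are provided for them) (campaign D-0069: "each
inference as a kernel lemma over the typed statements, or the exact non-following inference
isolated"). Theorem-only; 0 new definitions, 0 new facts.

| printed inference (Z22 p.74–75) | kernel theorem | inputs |
|---|---|---|
| (13.1) line 1 ⇒ line 2 ("and (2.2)") | `eq131b_of_eq131a` | functional equation (2.2) (`GammaFactor.LFunction_eq_Zfac_mul`), `t₀⁻¹ ≤ 𝓛⁻¹²³` |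
| "Hence (13.2)" | `eq132_of` | `U001`, `U002`, (2.2) at `ρ + β₂` |
| "We insert this into (13.2) and then … into (13.1). Thus we obtain (13.3)" | `eq133_of` | `Prop22i`, `Eq131a` (line 1!), `Eq132`, `U003`; error = `E₁*` EXACTLY |
| "Inserting this into (12.4) we obtain (13.7)" | `Typed.Section13.eq137_of_u005` (in `TypedSection13`) | `U005` |

NOT derivable as printed (recorded in the cell's plan/GAP-LEDGER.md, typed AS PRINTED in
`TypedSection13`): G-L3t6-1 — the first line of (13.1) (`Eq131a`, error `O(1/t₀)`) is attributed
to Lemma 5.2, which yields only `O(𝓛⁻¹²³)` (= the second line `Eq131b`); `eq133_of` shows the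
`t₀⁻¹`-term of `E₁*` needs the first line. G-L3t6-2 — the display after (13.3) (`U005`) drops the
`O(𝓛⁻¹⁰⁰)`-remainder of Lemma 4.8, so `U005 ⇍ Eq133 ∧ Skeleton.Lemma48` with an absolute constant.
G-L3t6-3 — (13.11) "we can verify that `𝓔 = o(𝔓)`" is not carried out in print.

Auxiliary facts proved on the way (all elementary): `α = π𝓛⁻⁹`; `|β_j| ≤ 3α(1 + 5|c′|π)`;
eventually (in `D`, given `c′`) `Im(ρ + β_j) > 0` and `|β_j| ≤ 1`; `β₁ + β₂ = β₃`; `Re β_j = 0`;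
`|Z(s,ψ)| = 1` and `|(pt₀)^{β}| = 1` on the critical line; `conj K(s,ψ) = K(s̄,ψ̄)`,
`conj N(w,ψ̄) = N(w̄,ψ)`; Lemma 6.1 conjugated on the critical line (`lemma61_conj_form`).

## References

* Y. Zhang, arXiv:2211.02515v1 (2022), §13 pp. 74–75; §2 (2.2), (2.13), (2.14); §5 Lemma 5.1;
  §6 Lemma 6.1. [cite: Zhang2022LandauSiegel, §13]
-/

noncomputable section

open Complex Real ComplexConjugate

namespace Literature.NumberTheory.LFunctions.Zhang2022.Typed.Section13

open Skeleton

variable {c' c₀ : ℝ}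

/-! ## Kernel-checked edges inside §13: (13.1) line 2 ⇐ line 1; (13.2) ⇐ u001 + u002;
(13.3) ⇐ (13.1) line 1 + (13.2) + u003 (with Prop. 2.2 (i)) -/

section Edges

/-- `α = π/𝓛⁹` (`P = exp{𝓛⁹}`, `α = π/log P`, (2.6), (2.10); the tree's public copy is
`Section2.alpha_eq_pi_div_ell9` in `TypedSection01and02B`, re-proved privately here to keep the
import list small). [cite: Zhang2022LandauSiegel, §2 (2.10)] -/
private theorem alpha_eq (D : ℕ) : alpha D = π / ell D ^ 9 := by
  rw [alpha, bigP, Real.log_exp]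

/-- For `𝓛 ≥ 1`: `0 ≤ α ≤ π` and `α𝓛 ≤ π`. [cite: Zhang2022LandauSiegel, §2 (2.10)] -/
theorem alpha_bounds {D : ℕ} (h : 1 ≤ ell D) :
    0 ≤ alpha D ∧ alpha D ≤ π ∧ alpha D * ell D ≤ π := by
  have hℓ9 : 1 ≤ ell D ^ 9 := one_le_pow₀ h
  rw [alpha_eq]
  refine ⟨by positivity, div_le_self Real.pi_pos.le hℓ9, ?_⟩
  rw [div_mul_eq_mul_div, div_le_iff₀ (by positivity)]
  exact mul_le_mul_of_nonneg_left (le_self_pow₀ h (by norm_num)) Real.pi_pos.le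

/-- The shifts are small: `‖β_j‖ ≤ 3α(1 + 5|c′|π)` for `j = 1, 2, 3` once `𝓛 ≥ 1` ((2.13):
`|β₁| = α|1 − 5c′α𝓛|`, `|β₂| = 2α|1 + c′α𝓛|`, `|β₃| = 3α|1 − c′α𝓛|`, and `α𝓛 ≤ π`).
[cite: Zhang2022LandauSiegel, §2 (2.13)] -/
theorem norm_beta_le (c' : ℝ) {D : ℕ} (h : 1 ≤ ell D) :
    ‖beta1 c' D‖ ≤ 3 * alpha D * (1 + 5 * |c'| * π) ∧
      ‖beta2 c' D‖ ≤ 3 * alpha D * (1 + 5 * |c'| * π) ∧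
        ‖beta3 c' D‖ ≤ 3 * alpha D * (1 + 5 * |c'| * π) := by
  obtain ⟨hα0, hαπ, hαℓ⟩ := alpha_bounds h
  have hπ : 0 < π := Real.pi_pos
  have hc : 0 ≤ |c'| := abs_nonneg _
  have hx : |c' * alpha D * ell D| ≤ |c'| * π := by
    rw [mul_assoc, abs_mul, abs_of_nonneg (mul_nonneg hα0 (le_trans zero_le_one h))]
    exact mul_le_mul_of_nonneg_left hαℓ hc
  obtain ⟨hxa, hxb⟩ := abs_le.mp hx
  have h1 : |1 - 5 * c' * alpha D * ell D| ≤ 1 + 5 * |c'| * π := by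
    rw [abs_le]; constructor <;> nlinarith
  have h2 : |1 + c' * alpha D * ell D| ≤ 1 + |c'| * π := by
    rw [abs_le]; constructor <;> linarith
  have h3 : |1 - c' * alpha D * ell D| ≤ 1 + |c'| * π := by
    rw [abs_le]; constructor <;> linarith
  have n1 : ‖beta1 c' D‖ = alpha D * |1 - 5 * c' * alpha D * ell D| := by
    rw [beta1, norm_mul, norm_mul, Complex.norm_I, Complex.norm_real, Complex.norm_real,
      Real.norm_eq_abs, Real.norm_eq_abs, abs_of_nonneg hα0, one_mul]
  have n2 : ‖beta2 c' D‖ = 2 * alpha D * |1 + c' * alpha D * ell D| := by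
    rw [beta2, norm_mul, norm_mul, norm_mul, Complex.norm_I, Complex.norm_real, Complex.norm_real,
      Real.norm_eq_abs, Real.norm_eq_abs, abs_of_nonneg hα0, Complex.norm_ofNat, mul_one]
  have n3 : ‖beta3 c' D‖ = 3 * alpha D * |1 - c' * alpha D * ell D| := by
    rw [beta3, norm_mul, norm_mul, norm_mul, Complex.norm_I, Complex.norm_real, Complex.norm_real,
      Real.norm_eq_abs, Real.norm_eq_abs, abs_of_nonneg hα0, Complex.norm_ofNat, mul_one]
  have k1 : alpha D * |1 - 5 * c' * alpha D * ell D| ≤ alpha D * (1 + 5 * |c'| * π) :=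
    mul_le_mul_of_nonneg_left h1 hα0
  have k2 : alpha D * |1 + c' * alpha D * ell D| ≤ alpha D * (1 + |c'| * π) :=
    mul_le_mul_of_nonneg_left h2 hα0
  have k3 : alpha D * |1 - c' * alpha D * ell D| ≤ alpha D * (1 + |c'| * π) :=
    mul_le_mul_of_nonneg_left h3 hα0
  have hcα : 0 ≤ alpha D * (|c'| * π) := mul_nonneg hα0 (mul_nonneg hc hπ.le)
  rw [n1, n2, n3]
  refine ⟨?_, ?_, ?_⟩ <;> nlinarith [hcα, hα0]

/-- For `D` large (depending on `c′`), the shifted points `ρ + β_j` (`ρ ∈ 𝔷(ψ)`, `j = 1, 2, 3`) lie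
in the upper half-plane: `Im ρ > 2πt₀ − 𝓛₁ ≥ 5𝓛` (2.14) while `|β_j| ≤ 3π(1 + 5|c′|π) ≤ 𝓛`.
[cite: Zhang2022LandauSiegel, §2 (2.13)–(2.14)] -/
theorem im_add_beta_pos (c' : ℝ) : ∃ D₁ : ℕ, ∀ D : ℕ, D₁ ≤ D → ∀ x : Chr D, ∀ ρ ∈ zeroSet D x,
    0 < (ρ + beta1 c' D).im ∧ 0 < (ρ + beta2 c' D).im ∧ 0 < (ρ + beta3 c' D).im := by
  refine ⟨max 3 ⌈Real.exp (3 * π * (1 + 5 * |c'| * π))⌉₊, fun D hD x ρ hρ => ?_⟩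
  have hD3 : 3 ≤ D := le_trans (le_max_left _ _) hD
  have hℓ1 : 1 < ell D := one_lt_ell hD3
  have hM : 3 * π * (1 + 5 * |c'| * π) ≤ ell D := by
    have hDpos : (0 : ℝ) < D := by exact_mod_cast lt_of_lt_of_le (by norm_num : 0 < 3) hD3
    have h : Real.exp (3 * π * (1 + 5 * |c'| * π)) ≤ D :=
      le_trans (Nat.le_ceil _) (by exact_mod_cast le_trans (le_max_right _ _) hD)
    exact (Real.le_log_iff_exp_le hDpos).mpr h
  obtain ⟨-, him, -⟩ := hρ
  have hπ : 3 < π := Real.pi_gt_three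
  have ht0 : ell D ≤ t0 D := le_self_pow₀ hℓ1.le (by norm_num)
  have h11 : ell1 D ≤ t0 D := pow_le_pow_right₀ hℓ1.le (by norm_num)
  have hρim : 5 * ell D < ρ.im := by
    have h1 := (abs_lt.mp him).1
    nlinarith
  obtain ⟨b1, b2, b3⟩ := norm_beta_le c' hℓ1.le
  obtain ⟨hα0, hαπ, -⟩ := alpha_bounds hℓ1.le
  have hK : 3 * alpha D * (1 + 5 * |c'| * π) ≤ 3 * π * (1 + 5 * |c'| * π) := by gcongr
  have i1 := (abs_le.mp (le_trans (Complex.abs_im_le_norm _) (le_trans b1 hK))).1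
  have i2 := (abs_le.mp (le_trans (Complex.abs_im_le_norm _) (le_trans b2 hK))).1
  have i3 := (abs_le.mp (le_trans (Complex.abs_im_le_norm _) (le_trans b3 hK))).1
  have hMpos : 0 < 3 * π * (1 + 5 * |c'| * π) := by positivity
  simp only [Complex.add_im]
  refine ⟨by linarith, by linarith, by linarith⟩

/-- `Re β₃ = 0` (the shifts (2.13) are purely imaginary). [cite: Zhang2022LandauSiegel, §2 (2.13)] -/
theorem beta3_re (c' : ℝ) (D : ℕ) : (beta3 c' D).re = 0 := by
  simp [beta3]

/-- `E₁(s,ψ) ≥ 0` for the parametrised error of Lemma 6.1. [cite: Zhang2022LandauSiegel, §6 Lemma 6.1] -/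
theorem E1full_nonneg (c₀ : ℝ) {D : ℕ} (x : Chr D) (s : ℂ) : 0 ≤ E1full c₀ x s :=
  add_nonneg (E1main_nonneg x s) (Real.exp_nonneg _)

/-- **(13.1): the second line follows from the first** (Z22 p.74, tex L3733–3737), kernel-checked:
by the functional equation (2.2) at `s = ρ + β₃` (`Z(s,ψ)⁻¹L(s,ψ) = L(1−s,ψ̄)` exactly, `Im s > 0`)
the two displayed main terms coincide, and `t₀⁻¹ = 𝓛⁻⁵¹⁹ ≤ 𝓛⁻¹²³`.
[cite: Zhang2022LandauSiegel, §13 (13.1), p. 74] -/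
theorem eq131b_of_eq131a (h : Eq131a c') : Eq131b c' := by
  obtain ⟨C, D₀, hC⟩ := h
  obtain ⟨D₁, hD₁⟩ := im_add_beta_pos c'
  refine ⟨|C|, max D₀ (max D₁ 3), fun D _ χ hD hq hp hA x hx ρ hρ => ?_⟩
  have hD₀ : D₀ ≤ D := le_trans (le_max_left _ _) hD
  have hD1 : D₁ ≤ D := le_trans (le_trans (le_max_left _ _) (le_max_right _ _)) hD
  have hD3 : 3 ≤ D := le_trans (le_trans (le_max_right _ _) (le_max_right _ _)) hD
  have hℓ1 : 1 < ell D := one_lt_ell hD3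
  obtain ⟨-, -, him3⟩ := hD₁ D hD1 x ρ hρ
  have hb := hC D χ hD₀ hq hp hA x hx ρ hρ
  dsimp only at hb ⊢
  have hFE := GammaFactor.LFunction_eq_Zfac_mul x.prim x.p_ne_one (ne_of_gt him3)
  have hZ : GammaFactor.Zfac x.ψ (ρ + beta3 c' D) ≠ 0 := GammaFactor.Zfac_ne_zero x.prim him3
  have hLb : x.ψ⁻¹.LFunction (1 - ρ - beta3 c' D) =
      (GammaFactor.Zfac x.ψ (ρ + beta3 c' D))⁻¹ * x.ψ.LFunction (ρ + beta3 c' D) := by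
    rw [sub_sub, hFE, ← mul_assoc, inv_mul_cancel₀ hZ, one_mul]
  have hT : -I * (x.ψ.LFunction (ρ + beta1 c' D) * x.ψ.LFunction (ρ + beta2 c' D) *
        x.ψ⁻¹.LFunction (1 - ρ - beta3 c' D) / deriv x.ψ.LFunction ρ) =
      -I * (GammaFactor.Zfac x.ψ (ρ + beta3 c' D))⁻¹ *
        (x.ψ.LFunction (ρ + beta1 c' D) * x.ψ.LFunction (ρ + beta2 c' D) *
          x.ψ.LFunction (ρ + beta3 c' D) / deriv x.ψ.LFunction ρ) := by
    rw [hLb]; ring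
  rw [hT]
  have ht : (t0 D)⁻¹ ≤ (ell D ^ 123)⁻¹ := by
    rw [t0]; exact inv_anti₀ (pow_pos (by linarith) _) (pow_le_pow_right₀ hℓ1.le (by norm_num))
  have ht0 : 0 ≤ (t0 D)⁻¹ := by rw [t0]; exact inv_nonneg.mpr (pow_nonneg (by linarith) _)
  have h1 : C * (t0 D)⁻¹ ≤ |C| * (ell D ^ 123)⁻¹ :=
    calc C * (t0 D)⁻¹ ≤ |C| * (t0 D)⁻¹ := mul_le_mul_of_nonneg_right (le_abs_self C) ht0
      _ ≤ |C| * (ell D ^ 123)⁻¹ := mul_le_mul_of_nonneg_left ht (abs_nonneg C)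
  exact le_trans hb (mul_le_mul_of_nonneg_right h1 (norm_nonneg _))

/-- **(13.2) from the two displays before it** (Z22 p.74, tex L3738–3752, "Hence"), kernel-checked:
`L(ρ+β₂,ψ)L(1−ρ−β₃,ψ̄) = L(ρ+β₂,ψ)[K(1−ρ−β₃,ψ̄) + Z(ρ+β₃,ψ)⁻¹N(ρ+β₃,ψ) + O(E₁)]`,
`Z(ρ+β₃,ψ)⁻¹ = Z(ρ+β₂,ψ)⁻¹(pt₀)^{β₁} + O(𝓛⁻¹²³)`, and `L(ρ+β₂,ψ)Z(ρ+β₂,ψ)⁻¹ = L(1−ρ−β₂,ψ̄)` by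
(2.2) (`Im(ρ+β₂) > 0`); constant `max(|C₁|,|C₂|)`. [cite: Zhang2022LandauSiegel, §13 (13.2), p. 74] -/
theorem eq132_of (h1 : U001 c' c₀) (h2 : U002 c') : Eq132 c' c₀ := by
  obtain ⟨C₁, D₀, hC₁⟩ := h1
  obtain ⟨C₂, D₀', hC₂⟩ := h2
  obtain ⟨D₁, hD₁⟩ := im_add_beta_pos c'
  refine ⟨max |C₁| |C₂|, max (max D₀ D₀') D₁, fun D _ χ hD hq hp hA x hx ρ hρ => ?_⟩
  have hD₀ : D₀ ≤ D := le_trans (le_trans (le_max_left _ _) (le_max_left _ _)) hD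
  have hD₀' : D₀' ≤ D := le_trans (le_trans (le_max_right _ _) (le_max_left _ _)) hD
  have hD1 : D₁ ≤ D := le_trans (le_max_right _ _) hD
  have e1 := (hC₁ D χ hD₀ hq hp hA x hx ρ hρ).2
  have e2 := hC₂ D χ hD₀' hq hp hA x hx ρ hρ
  obtain ⟨-, him2, -⟩ := hD₁ D hD1 x ρ hρ
  have hFE := GammaFactor.LFunction_eq_Zfac_mul x.prim x.p_ne_one (ne_of_gt him2)
  have hZ2 : GammaFactor.Zfac x.ψ (ρ + beta2 c' D) ≠ 0 := GammaFactor.Zfac_ne_zero x.prim him2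
  set L₂ := x.ψ.LFunction (ρ + beta2 c' D) with hL₂
  set Lb₃ := x.ψ⁻¹.LFunction (1 - ρ - beta3 c' D)
  set Lb₂ := x.ψ⁻¹.LFunction (1 - ρ - beta2 c' D) with hLb₂def
  set K₃ := Kchar D (psiBarFn x) (1 - ρ - beta3 c' D)
  set N₃ := Nchar D (psiFn x) (ρ + beta3 c' D)
  set Z₃ := GammaFactor.Zfac x.ψ (ρ + beta3 c' D)
  set Z₂ := GammaFactor.Zfac x.ψ (ρ + beta2 c' D)
  set w₁ := (((x.p : ℝ) * t0 D : ℝ) : ℂ) ^ beta1 c' D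
  set E₃ := E1full c₀ x (ρ + beta3 c' D)
  have hLb2 : Lb₂ = Z₂⁻¹ * L₂ := by
    rw [hLb₂def, sub_sub, hFE, ← mul_assoc, inv_mul_cancel₀ hZ2, one_mul]
  have hid : L₂ * Lb₃ - (L₂ * K₃ + w₁ * N₃ * Lb₂) =
      L₂ * (Lb₃ - K₃ - Z₃⁻¹ * N₃) + L₂ * N₃ * (Z₃⁻¹ - Z₂⁻¹ * w₁) := by
    rw [hLb2]; ring
  rw [hid]
  have hE₃ : 0 ≤ E₃ := E1full_nonneg c₀ x _
  have hℓ : 0 ≤ (ell D ^ 123)⁻¹ := inv_nonneg.mpr (pow_nonneg (Real.log_natCast_nonneg D) _)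
  have hM1 : C₁ ≤ max |C₁| |C₂| := le_trans (le_abs_self _) (le_max_left _ _)
  have hM2 : C₂ ≤ max |C₁| |C₂| := le_trans (le_abs_self _) (le_max_right _ _)
  calc ‖L₂ * (Lb₃ - K₃ - Z₃⁻¹ * N₃) + L₂ * N₃ * (Z₃⁻¹ - Z₂⁻¹ * w₁)‖
      ≤ ‖L₂‖ * ‖Lb₃ - K₃ - Z₃⁻¹ * N₃‖ + ‖L₂ * N₃‖ * ‖Z₃⁻¹ - Z₂⁻¹ * w₁‖ := by
        refine le_trans (norm_add_le _ _) ?_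
        rw [norm_mul, norm_mul (L₂ * N₃)]
    _ ≤ ‖L₂‖ * (C₁ * E₃) + ‖L₂ * N₃‖ * (C₂ * (ell D ^ 123)⁻¹) := by
        gcongr
    _ ≤ ‖L₂‖ * (max |C₁| |C₂| * E₃) + ‖L₂ * N₃‖ * (max |C₁| |C₂| * (ell D ^ 123)⁻¹) := by
        gcongr
    _ = max |C₁| |C₂| * (‖L₂ * N₃‖ * (ell D ^ 123)⁻¹ + ‖L₂‖ * E₃) := by ring

/-- **(13.3) from (13.1) [first line], (13.2) and the display after (13.2)** (Z22 p.74, tex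
L3759–3773: "We insert this into (13.2) and then insert the result into (13.1). Thus we obtain
(13.3)"), kernel-checked, with the zeros on the critical line (Proposition 2.2 (i), so that
`|Z(ρ+β₃,ψ)| = 1`) and the exact functional equation (2.2) at `ρ + β₃`: the accumulated error is
EXACTLY a constant times the printed `E₁*(ρ,ψ)` — its `t₀⁻¹`-term is the `O(1/t₀)` of the FIRST line
of (13.1) (the second line's `O(𝓛⁻¹²³)` would not suffice). [cite: Zhang2022LandauSiegel, §13 (13.3), p. 74] -/
theorem eq133_of (h22 : Skeleton.Prop22i) (h131 : Eq131a c') (h132 : Eq132 c' c₀)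
    (h3 : U003 c' c₀) : Eq133 c' c₀ := by
  obtain ⟨D22, h22'⟩ := h22
  obtain ⟨C₁, D₁', hC₁⟩ := h131
  obtain ⟨C₂, D₂', hC₂⟩ := h132
  obtain ⟨C₃, D₃', hC₃⟩ := h3
  obtain ⟨D₁, hD₁⟩ := im_add_beta_pos c'
  refine ⟨|C₁| + |C₂| + |C₃|, max (max (max D22 D₁') (max D₂' D₃')) D₁,
    fun D _ χ hD hq hp hA x hx ρ hρ => ?_⟩
  have hD22 : D22 ≤ D :=
    le_trans (le_trans (le_trans (le_max_left _ _) (le_max_left _ _)) (le_max_left _ _)) hD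
  have hD1' : D₁' ≤ D :=
    le_trans (le_trans (le_trans (le_max_right _ _) (le_max_left _ _)) (le_max_left _ _)) hD
  have hD2' : D₂' ≤ D :=
    le_trans (le_trans (le_trans (le_max_left _ _) (le_max_right _ _)) (le_max_left _ _)) hD
  have hD3' : D₃' ≤ D :=
    le_trans (le_trans (le_trans (le_max_right _ _) (le_max_right _ _)) (le_max_left _ _)) hD
  have hD1 : D₁ ≤ D := le_trans (le_max_right _ _) hD
  have hre : ρ.re = 1 / 2 := h22' D χ hD22 hq hp x hx ρ (mem_prodZeroSetOmega_of_mem_zeroSet χ hρ)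
  obtain ⟨-, -, him3⟩ := hD₁ D hD1 x ρ hρ
  have b1 := hC₁ D χ hD1' hq hp hA x hx ρ hρ
  have b2 := hC₂ D χ hD2' hq hp hA x hx ρ hρ
  have b3 := hC₃ D χ hD3' hq hp hA x hx ρ hρ
  dsimp only at b1
  have hFE := GammaFactor.LFunction_eq_Zfac_mul x.prim x.p_ne_one (ne_of_gt him3)
  have hZ : GammaFactor.Zfac x.ψ (ρ + beta3 c' D) ≠ 0 := GammaFactor.Zfac_ne_zero x.prim him3
  have hZn : ‖GammaFactor.Zfac x.ψ (ρ + beta3 c' D)‖ = 1 := by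
    have hs : ρ + beta3 c' D = 1 / 2 + ((ρ + beta3 c' D).im : ℂ) * I :=
      Complex.ext (by simp [hre, beta3_re]) (by simp)
    rw [hs]; exact GammaFactor.norm_Zfac_half_eq_one x.prim (by simpa using him3)
  rw [E1star, main133]
  set cs := cstar c' D x ρ
  set L₁ := x.ψ.LFunction (ρ + beta1 c' D)
  set L₂ := x.ψ.LFunction (ρ + beta2 c' D)
  set L₃ := x.ψ.LFunction (ρ + beta3 c' D)
  set L' := deriv x.ψ.LFunction ρ
  set Lb₃ := x.ψ⁻¹.LFunction (1 - ρ - beta3 c' D) with hLb₃def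
  set Lb₂ := x.ψ⁻¹.LFunction (1 - ρ - beta2 c' D)
  set K₃ := Kchar D (psiBarFn x) (1 - ρ - beta3 c' D)
  set K₂ := Kchar D (psiBarFn x) (1 - ρ - beta2 c' D)
  set N₃ := Nchar D (psiFn x) (ρ + beta3 c' D)
  set N₂ := Nchar D (psiFn x) (ρ + beta2 c' D)
  set Z₃ := GammaFactor.Zfac x.ψ (ρ + beta3 c' D)
  set Z₀ := GammaFactor.Zfac x.ψ ρ
  set w₁ := (((x.p : ℝ) * t0 D : ℝ) : ℂ) ^ beta1 c' D
  set w₃ := (((x.p : ℝ) * t0 D : ℝ) : ℂ) ^ beta3 c' D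
  set E₃ := E1full c₀ x (ρ + beta3 c' D)
  set E₂ := E1full c₀ x (ρ + beta2 c' D)
  set τ := (t0 D)⁻¹
  set ℓ := (ell D ^ 123)⁻¹
  have hLb3 : Lb₃ = Z₃⁻¹ * L₃ := by
    rw [hLb₃def, sub_sub, hFE, ← mul_assoc, inv_mul_cancel₀ hZ, one_mul]
  -- the decomposition of `𝒞* − main` along the printed insertions
  set Ta := -I * Z₃⁻¹ * (L₁ * L₂ * L₃ / L') with hTa
  set A := L₂ * Lb₃ - (L₂ * K₃ + w₁ * N₃ * Lb₂) with hA
  set B := w₁ * Lb₂ - (w₁ * K₂ + w₃ * Z₀⁻¹ * N₂) with hB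
  have hid : cs - (-I * (L₁ * L₂ / L') * K₃ - I * w₁ * (L₁ / L') * N₃ * K₂ -
        I * w₃ * Z₀⁻¹ * (L₁ / L') * N₂ * N₃) =
      (cs - Ta) + (-I) * (L₁ / L') * A + (-I) * (L₁ / L') * N₃ * B := by
    rw [hTa, hA, hB, hLb3]; ring
  rw [hid]
  -- nonnegativity bookkeeping
  have hE₃ : 0 ≤ E₃ := E1full_nonneg c₀ x _
  have hE₂ : 0 ≤ E₂ := E1full_nonneg c₀ x _
  have hℓ0 : 0 ≤ ℓ := inv_nonneg.mpr (pow_nonneg (Real.log_natCast_nonneg D) _)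
  have hτ0 : 0 ≤ τ := inv_nonneg.mpr (pow_nonneg (Real.log_natCast_nonneg D) _)
  have hS1 : C₁ ≤ |C₁| + |C₂| + |C₃| := by linarith [le_abs_self C₁, abs_nonneg C₂, abs_nonneg C₃]
  have hS2 : C₂ ≤ |C₁| + |C₂| + |C₃| := by linarith [le_abs_self C₂, abs_nonneg C₁, abs_nonneg C₃]
  have hS3 : C₃ ≤ |C₁| + |C₂| + |C₃| := by linarith [le_abs_self C₃, abs_nonneg C₁, abs_nonneg C₂]
  -- norms of the three pieces
  have nI : ‖(-I : ℂ)‖ = 1 := by simp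
  have nTa : ‖Ta‖ = ‖L₁ * L₂ / L'‖ * ‖L₃‖ := by
    rw [hTa, norm_mul, norm_mul, nI, norm_inv, hZn, inv_one, one_mul, one_mul,
      show L₁ * L₂ * L₃ / L' = L₁ * L₂ / L' * L₃ by ring, norm_mul]
  have p1 : ‖cs - Ta‖ ≤ (|C₁| + |C₂| + |C₃|) * (‖L₁ * L₂ / L'‖ * (‖L₃‖ * τ)) := by
    refine le_trans b1 ?_
    rw [nTa]
    have : C₁ * τ * (‖L₁ * L₂ / L'‖ * ‖L₃‖) ≤ (|C₁| + |C₂| + |C₃|) * (τ * (‖L₁ * L₂ / L'‖ * ‖L₃‖)) := by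
      rw [mul_assoc]
      exact mul_le_mul_of_nonneg_right hS1
        (mul_nonneg hτ0 (mul_nonneg (norm_nonneg _) (norm_nonneg _)))
    linarith
  have p2 : ‖(-I) * (L₁ / L') * A‖ ≤
      (|C₁| + |C₂| + |C₃|) * (‖L₁ * L₂ / L'‖ * (‖N₃‖ * ℓ + E₃)) := by
    rw [norm_mul, norm_mul, nI, one_mul]
    have q : ‖L₁ / L'‖ * ‖A‖ ≤ ‖L₁ / L'‖ * (C₂ * (‖L₂ * N₃‖ * ℓ + ‖L₂‖ * E₃)) :=
      mul_le_mul_of_nonneg_left b2 (norm_nonneg _)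
    have r1 : ‖L₁ / L'‖ * ‖L₂ * N₃‖ = ‖L₁ * L₂ / L'‖ * ‖N₃‖ := by
      rw [← norm_mul, ← norm_mul]; congr 1; ring
    have r2 : ‖L₁ / L'‖ * ‖L₂‖ = ‖L₁ * L₂ / L'‖ := by
      rw [← norm_mul]; congr 1; ring
    have q' : ‖L₁ / L'‖ * (C₂ * (‖L₂ * N₃‖ * ℓ + ‖L₂‖ * E₃)) =
        C₂ * (‖L₁ * L₂ / L'‖ * (‖N₃‖ * ℓ + E₃)) := by
      calc _ = C₂ * ((‖L₁ / L'‖ * ‖L₂ * N₃‖) * ℓ + (‖L₁ / L'‖ * ‖L₂‖) * E₃) := by ring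
        _ = _ := by rw [r1, r2]; ring
    have s : C₂ * (‖L₁ * L₂ / L'‖ * (‖N₃‖ * ℓ + E₃)) ≤
        (|C₁| + |C₂| + |C₃|) * (‖L₁ * L₂ / L'‖ * (‖N₃‖ * ℓ + E₃)) :=
      mul_le_mul_of_nonneg_right hS2
        (mul_nonneg (norm_nonneg _) (add_nonneg (mul_nonneg (norm_nonneg _) hℓ0) hE₃))
    linarith
  have p3 : ‖(-I) * (L₁ / L') * N₃ * B‖ ≤
      (|C₁| + |C₂| + |C₃|) * (‖L₁ * N₃ / L'‖ * (‖N₂‖ * ℓ + E₂)) := by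
    rw [norm_mul, norm_mul, norm_mul, nI, one_mul]
    have r3 : ‖L₁ / L'‖ * ‖N₃‖ = ‖L₁ * N₃ / L'‖ := by
      rw [← norm_mul]; congr 1; ring
    rw [r3]
    have q : ‖L₁ * N₃ / L'‖ * ‖B‖ ≤ ‖L₁ * N₃ / L'‖ * (C₃ * (‖N₂‖ * ℓ + E₂)) :=
      mul_le_mul_of_nonneg_left b3 (norm_nonneg _)
    have s : C₃ * (‖L₁ * N₃ / L'‖ * (‖N₂‖ * ℓ + E₂)) ≤
        (|C₁| + |C₂| + |C₃|) * (‖L₁ * N₃ / L'‖ * (‖N₂‖ * ℓ + E₂)) :=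
      mul_le_mul_of_nonneg_right hS3
        (mul_nonneg (norm_nonneg _) (add_nonneg (mul_nonneg (norm_nonneg _) hℓ0) hE₂))
    linarith
  calc ‖cs - Ta + -I * (L₁ / L') * A + -I * (L₁ / L') * N₃ * B‖
      ≤ ‖cs - Ta‖ + ‖-I * (L₁ / L') * A‖ + ‖-I * (L₁ / L') * N₃ * B‖ := norm_add₃_le
    _ ≤ (|C₁| + |C₂| + |C₃|) * (‖L₁ * L₂ / L'‖ * (‖L₃‖ * τ)) +
        (|C₁| + |C₂| + |C₃|) * (‖L₁ * L₂ / L'‖ * (‖N₃‖ * ℓ + E₃)) +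
        (|C₁| + |C₂| + |C₃|) * (‖L₁ * N₃ / L'‖ * (‖N₂‖ * ℓ + E₂)) := by linarith
    _ = (|C₁| + |C₂| + |C₃|) * (‖L₁ * L₂ / L'‖ * (‖L₃‖ * τ + ‖N₃‖ * ℓ + E₃) +
        ‖L₁ * N₃ / L'‖ * (‖N₂‖ * ℓ + E₂)) := by ring

/-- `Re β₁ = 0`. [cite: Zhang2022LandauSiegel, §2 (2.13)] -/
theorem beta1_re (c' : ℝ) (D : ℕ) : (beta1 c' D).re = 0 := by
  simp [beta1]

/-- `Re β₂ = 0`. [cite: Zhang2022LandauSiegel, §2 (2.13)] -/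
theorem beta2_re (c' : ℝ) (D : ℕ) : (beta2 c' D).re = 0 := by
  simp [beta2]

/-- **`β₁ + β₂ = β₃`** (2.13): `iα(1 − 5c′α𝓛) + 2iα(1 + c′α𝓛) = 3iα(1 − c′α𝓛)`.
[cite: Zhang2022LandauSiegel, §2 (2.13)] -/
theorem beta1_add_beta2 (c' : ℝ) (D : ℕ) : beta1 c' D + beta2 c' D = beta3 c' D := by
  simp only [beta1, beta2, beta3]
  push_cast
  ring

/-- `β₁ = iv₁` with the real `v₁ = α(1 − 5c′α𝓛)`. [cite: Zhang2022LandauSiegel, §2 (2.13)] -/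
theorem beta1_eq_mul_I (c' : ℝ) (D : ℕ) :
    beta1 c' D = ((alpha D * (1 - 5 * c' * alpha D * ell D) : ℝ) : ℂ) * I := by
  simp only [beta1]
  push_cast
  ring

/-- Eventually (in `D`, depending on `c′`) the shifts are tiny: `‖β_j‖ ≤ 1` (`j = 1, 2, 3`) and
`5|c′|α𝓛 ≤ 1/2` (since `α = π𝓛⁻⁹`). [cite: Zhang2022LandauSiegel, §2 (2.13)] -/
theorem beta_small (c' : ℝ) : ∃ D₂ : ℕ, ∀ D : ℕ, D₂ ≤ D →
    ‖beta1 c' D‖ ≤ 1 ∧ ‖beta2 c' D‖ ≤ 1 ∧ ‖beta3 c' D‖ ≤ 1 ∧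
      5 * |c'| * (alpha D * ell D) ≤ 1 / 2 := by
  refine ⟨max 3 ⌈Real.exp (3 * π * (1 + 5 * |c'| * π) + 10 * |c'| * π)⌉₊, fun D hD => ?_⟩
  have hD3 : 3 ≤ D := le_trans (le_max_left _ _) hD
  have hℓ1 : 1 < ell D := one_lt_ell hD3
  have hℓpos : 0 < ell D := by linarith
  have hM : 3 * π * (1 + 5 * |c'| * π) + 10 * |c'| * π ≤ ell D := by
    have hDpos : (0 : ℝ) < D := by exact_mod_cast lt_of_lt_of_le (by norm_num : 0 < 3) hD3
    have h : Real.exp (3 * π * (1 + 5 * |c'| * π) + 10 * |c'| * π) ≤ D :=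
      le_trans (Nat.le_ceil _) (by exact_mod_cast le_trans (le_max_right _ _) hD)
    exact (Real.le_log_iff_exp_le hDpos).mpr h
  obtain ⟨b1, b2, b3⟩ := norm_beta_le c' hℓ1.le
  have hα : alpha D = π / ell D ^ 9 := alpha_eq D
  have hαle : alpha D ≤ π / ell D := by
    rw [hα]
    exact div_le_div_of_nonneg_left Real.pi_pos.le hℓpos (le_self_pow₀ hℓ1.le (by norm_num))
  have hαℓ : alpha D * ell D ≤ π / ell D := by
    have h8 : alpha D * ell D = π / ell D ^ 8 := by
      rw [hα, div_mul_eq_mul_div, show ell D ^ 9 = ell D ^ 8 * ell D by ring,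
        mul_div_mul_right _ _ hℓpos.ne']
    rw [h8]
    exact div_le_div_of_nonneg_left Real.pi_pos.le hℓpos (le_self_pow₀ hℓ1.le (by norm_num))
  have hc : 0 ≤ |c'| := abs_nonneg _
  have hπ : 0 < π := Real.pi_pos
  have key : 3 * alpha D * (1 + 5 * |c'| * π) ≤ 1 := by
    calc 3 * alpha D * (1 + 5 * |c'| * π) ≤ 3 * (π / ell D) * (1 + 5 * |c'| * π) := by gcongr
      _ = (3 * π * (1 + 5 * |c'| * π)) / ell D := by ring
      _ ≤ 1 := by
          rw [div_le_one hℓpos]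
          nlinarith [mul_nonneg hc hπ.le]
  have key2 : 5 * |c'| * (alpha D * ell D) ≤ 1 / 2 := by
    calc 5 * |c'| * (alpha D * ell D) ≤ 5 * |c'| * (π / ell D) := by gcongr
      _ = (10 * |c'| * π) / ell D / 2 := by ring
      _ ≤ 1 / 2 := by
          have : (10 * |c'| * π) / ell D ≤ 1 := by
            rw [div_le_one hℓpos]
            nlinarith [mul_nonneg hc hπ.le]
          linarith
  exact ⟨le_trans b1 key, le_trans b2 key, le_trans b3 key, key2⟩

/-- On the critical line and in the upper half-plane, `|Z(s,ψ)| = 1` (the tree's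
`GammaFactor.norm_Zfac_half_eq_one`). [cite: Zhang2022LandauSiegel, §8 p. 43] -/
theorem norm_Zfac_eq_one_of_re {D : ℕ} (x : Chr D) {s : ℂ} (hre : s.re = 1 / 2) (him : 0 < s.im) :
    ‖GammaFactor.Zfac x.ψ s‖ = 1 := by
  have hs : s = 1 / 2 + (s.im : ℂ) * I := Complex.ext (by simp [hre]) (by simp)
  rw [hs]
  exact GammaFactor.norm_Zfac_half_eq_one x.prim (by simpa using him)

/-- `|(pt₀)^{β}| = 1` for a purely imaginary `β` (`p t₀ > 0`; used throughout §13 with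
`β = β₁, β₃`). [cite: Zhang2022LandauSiegel, §13 p. 74] -/
theorem norm_ptcpow_eq_one {D : ℕ} (hℓ : 1 < ell D) (x : Chr D) {β : ℂ} (hβ : β.re = 0) :
    ‖(((x.p : ℝ) * t0 D : ℝ) : ℂ) ^ β‖ = 1 := by
  have hpt : 0 < (x.p : ℝ) * t0 D :=
    mul_pos (Nat.cast_pos.mpr x.prime.pos) (by rw [t0]; exact pow_pos (by linarith) _)
  rw [Complex.norm_cpow_eq_rpow_re_of_pos hpt, hβ, Real.rpow_zero]

/-! ### Conjugation bookkeeping for "By Lemma 6.1" on the critical line -/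

/-- `conj (n^{−s}) = n^{−s̄}` for a natural number `n`. [folklore] -/
private theorem conj_natCast_cpow_neg (n : ℕ) (s : ℂ) :
    conj ((n : ℂ) ^ (-s)) = (n : ℂ) ^ (-conj s) := by
  have h := Complex.conj_cpow (n : ℂ) (-conj s)
    (by rw [Complex.natCast_arg]; exact Real.pi_pos.ne)
  rw [Complex.conj_natCast, map_neg, Complex.conj_conj] at h
  exact h.symm

/-- `conj K(s,ψ) = K(s̄,ψ̄)` (`g*` is real). [cite: Zhang2022LandauSiegel, §6 Lemma 6.1] -/
theorem conj_Kchar_psi {D : ℕ} (x : Chr D) (s : ℂ) :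
    conj (Kchar D (psiFn x) s) = Kchar D (psiBarFn x) (conj s) := by
  rw [Kchar, Kchar, map_sum]
  refine Finset.sum_congr rfl fun n _ => ?_
  rw [map_mul, map_mul, Complex.conj_ofReal, conj_natCast_cpow_neg]
  rfl

/-- `conj N(w,ψ̄) = N(w̄,ψ)`. [cite: Zhang2022LandauSiegel, §6 Lemma 6.1] -/
theorem conj_Nchar_psiBar {D : ℕ} (x : Chr D) (w : ℂ) :
    conj (Nchar D (psiBarFn x) w) = Nchar D (psiFn x) (conj w) := by
  rw [Nchar, Nchar, map_sum]
  refine Finset.sum_congr rfl fun n _ => ?_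
  rw [map_mul, map_mul, Complex.conj_ofReal, conj_natCast_cpow_neg]
  simp [psiFn, psiBarFn]

/-- On the critical line `s̄ = 1 − s`. [folklore] -/
private theorem conj_eq_one_sub {s : ℂ} (hre : s.re = 1 / 2) : conj s = 1 - s :=
  Complex.ext (by simp [hre]; norm_num) (by simp)

/-- **Lemma 6.1 conjugated on the critical line** (the step "By Lemma 6.1,
`L(1−s̄…,ψ̄) = conj L(s,ψ) = K(1−s,ψ̄) + Z(s,ψ)⁻¹N(s,ψ) + O(E₁(s,ψ))`" of §13 p.74, at `s = ρ + β₃`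
and `s = ρ + β₂`): for `Re s = 1/2`, `Im s > 0`, the pointwise inequality of Lemma 6.1 at `s` is
EQUIVALENT in norm to the conjugated display, since `conj K(s,ψ) = K(1−s,ψ̄)`, `conj Z(s,ψ) = Z(s,ψ)⁻¹`
(`|Z| = 1`), `conj N(1−s,ψ̄) = N(s,ψ)` and `conj L(s,ψ) = L(1−s,ψ̄)`. [cite: Zhang2022LandauSiegel, §13 p. 74, display after (13.1)] -/
theorem lemma61_conj_form {D : ℕ} (x : Chr D) {s : ℂ} (hre : s.re = 1 / 2) (him : 0 < s.im)
    {C E : ℝ}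
    (h : ‖x.ψ.LFunction s - Kchar D (psiFn x) s -
        GammaFactor.Zfac x.ψ s * Nchar D (psiBarFn x) (1 - s)‖ ≤ C * E) :
    x.ψ⁻¹.LFunction (1 - s) = conj (x.ψ.LFunction s) ∧
      ‖x.ψ⁻¹.LFunction (1 - s) - Kchar D (psiBarFn x) (1 - s) -
          (GammaFactor.Zfac x.ψ s)⁻¹ * Nchar D (psiFn x) s‖ ≤ C * E := by
  have hcs : conj s = 1 - s := conj_eq_one_sub hre
  have hL : x.ψ⁻¹.LFunction (1 - s) = conj (x.ψ.LFunction s) := by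
    rw [GammaFactor.LFunction_inv_conj_eq x.ψ_ne_one x.p_ne_one, map_sub, map_one, hcs,
      sub_sub_cancel]
  refine ⟨hL, ?_⟩
  have hZ : (GammaFactor.Zfac x.ψ s)⁻¹ = conj (GammaFactor.Zfac x.ψ s) :=
    Complex.inv_eq_conj (norm_Zfac_eq_one_of_re x hre him)
  have key : x.ψ⁻¹.LFunction (1 - s) - Kchar D (psiBarFn x) (1 - s) -
      (GammaFactor.Zfac x.ψ s)⁻¹ * Nchar D (psiFn x) s =
      conj (x.ψ.LFunction s - Kchar D (psiFn x) s -
        GammaFactor.Zfac x.ψ s * Nchar D (psiBarFn x) (1 - s)) := by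
    rw [map_sub, map_sub, map_mul, conj_Kchar_psi, conj_Nchar_psiBar, map_sub, map_one, hcs,
      sub_sub_cancel, hL, hZ]
  rw [key, Complex.norm_conj]
  exact h

/-- `β₂ = iv₂` with the real `v₂ = 2α(1 + c′α𝓛)`. [cite: Zhang2022LandauSiegel, §2 (2.13)] -/
theorem beta2_eq_mul_I (c' : ℝ) (D : ℕ) :
    beta2 c' D = ((2 * alpha D * (1 + c' * alpha D * ell D) : ℝ) : ℂ) * I := by
  simp only [beta2]
  push_cast
  ring



end Edges

end Literature.NumberTheory.LFunctions.Zhang2022.Typed.Section13
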